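import Summits.AtomisticToContinuum.HydrodynamicLimit.Theorems.ImplosionDichotomyPolynomialCompressionReferenceJets

/-!
# Reference jets II: the explicit derivative envelope of the reference implosion profile

Helper file for the line `log-lipschitz-budget` of the crux `ImplosionDichotomy.PolynomialCompression`
(stmt-AtomisticToContinuum-12587), stub `stub_logBudgetShadowing`. Every level-`k` assembly
(`k = 1, 2, 3`) of the `H³` shadowing estimate needs, at each time `t ∈ [0, T)`, uniform bounds on the
derivatives of the reference profile `(ρ₁, u₁, θ₁)` up to order `k + 1` and on the inverse weights,
as ONE explicit continuous envelope of polynomial growth in `1/(T₁ - t)`. The reference clauses of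
`ShadowSetting` (file `…ShadowingDefs`) provide: the reference is a classical solution (smooth slices,
`ρ₁ > 0`); Fréchet sup bounds `‖Dⁿ(ρ₁(t)∘proj)‖, ‖Dⁿ(u₁(t)∘proj)‖ ≤ Cpoly n (T₁−t)^{−ppoly n}` for
`n ≤ 6` (clause (R)); the no-vacuum floor `cl (T₁−t)^{pl} ≤ ρ₁` (clause (F)); the isentropic relation
`θ₁ = K ρ₁^{2/3}` (clause (Isen)). This file takes these clauses LITERALLY as hypotheses and concludes:

* `shadow_reference_partialDeriv_bounds` — (R) read out on the torus: the nested partial derivatives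
  of orders `0–4` of `ρ₁ t`, of `u₁ t` (in `V3`) and of its components are `≤ Cpoly n (T₁−t)^{−ppoly n}`;
* `shadow_reference_envelope` (registered) — with
  `Renv t := 576 (1 + K) (1 + Σ_{n<7} Cpoly n (T₁−t)^{−ppoly n})⁵ (1 + (cl (T₁−t)^{pl})⁻¹)⁵`
  and any `R ≥ Renv t`: `|ρ₁|, |θ₁|, ‖u₁‖, |u₁·c|` and ALL their nested partial derivatives of orders
  `1–4` at time `t` are `≤ R` (for `θ₁ = K ρ₁^{2/3}`: Faà di Bruno on the floor, part I);
* `shadow_reference_jets` — the same in the jet shape `|f x| ≤ R ∧ (∀ i, |∂ᵢf x| ≤ R) ∧ (∀ i j, …) ∧ …`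
  consumed by the pointwise `torusJet_*` product/chain bounds;
* `shadow_reference_envelope_weights` — the floor facts (`0 < m_t := cl (T₁−t)^{pl} ≤ ρ₁`,
  `ρ₁⁻¹ ≤ m_t⁻¹ ≤ R`, `c₁⁻¹ ≤ m_t^{−1/3} ≤ R`, `m_t^{1/3} ≤ c₁ ≤ R`, `c₁ := ρ₁^{1/3}`, `1 ≤ R`) and the
  derivatives of orders `1–4` of `c₁`, `ρ₁⁻¹`, `c₁⁻¹`, all `≤ R`;
* `shadow_reference_envelope_continuousOn` (`_Ico`) — `Renv` is continuous on `(-∞, T₁)` (on `[0, T)`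
  for `T ≤ T₁`), the input of the energy shell `torus_energy_le_of_balance`.
-/

noncomputable section

namespace Summit.AtomisticToContinuum.HydrodynamicLimit.Theorems

open Set MeasureTheory
open scoped ContDiff
open Literature.MathematicalPhysics.KineticTheory Literature.Analysis.FunctionSpaces

/-- **Clause (R) on the torus**: for a classical solution `(ρ₁, u₁, θ₁)` on `[0, T)` whose lifts obey
`‖Dⁿ(ρ₁(t)∘proj)‖, ‖Dⁿ(u₁(t)∘proj)‖ ≤ Cpoly n (T₁ − t)^{−ppoly n}` (`n ≤ 6`), at every `t ∈ [0, T)` the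
nested torus partial derivatives of orders `0–4` of `ρ₁ t`, of `u₁ t` and of each component `u₁ t · c`
are bounded by the same quantities. [folklore] -/
theorem shadow_reference_partialDeriv_bounds :
    ∀ {σ₁ T T₁ : ℝ} {Cpoly ppoly : ℕ → ℝ} {ρ₁ θ₁ : ℝ → T3 → ℝ} {u₁ : ℝ → T3 → V3},
      IsHardSphereEulerSolution σ₁ T ρ₁ u₁ θ₁ →
      (∀ n : ℕ, n ≤ 6 → ∀ t ∈ Ico 0 T, ∀ y : EuclideanSpace ℝ (Fin 3),
        ‖iteratedFDeriv ℝ n (Torus.lift (ρ₁ t)) y‖ ≤ Cpoly n * (T₁ - t) ^ (-ppoly n) ∧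
        ‖iteratedFDeriv ℝ n (Torus.lift (u₁ t)) y‖ ≤ Cpoly n * (T₁ - t) ^ (-ppoly n)) →
      ∀ {t : ℝ}, t ∈ Ico 0 T → ∀ (x : T3) (i j k l c : Fin 3),
        (|ρ₁ t x| ≤ Cpoly 0 * (T₁ - t) ^ (-ppoly 0) ∧
          |Torus.partialDeriv i (ρ₁ t) x| ≤ Cpoly 1 * (T₁ - t) ^ (-ppoly 1) ∧
          |Torus.partialDeriv i (Torus.partialDeriv j (ρ₁ t)) x| ≤ Cpoly 2 * (T₁ - t) ^ (-ppoly 2) ∧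
          |Torus.partialDeriv i (Torus.partialDeriv j (Torus.partialDeriv k (ρ₁ t))) x| ≤
            Cpoly 3 * (T₁ - t) ^ (-ppoly 3) ∧
          |Torus.partialDeriv i (Torus.partialDeriv j (Torus.partialDeriv k (Torus.partialDeriv l (ρ₁ t)))) x| ≤
            Cpoly 4 * (T₁ - t) ^ (-ppoly 4)) ∧
        (‖u₁ t x‖ ≤ Cpoly 0 * (T₁ - t) ^ (-ppoly 0) ∧
          ‖Torus.partialDeriv i (u₁ t) x‖ ≤ Cpoly 1 * (T₁ - t) ^ (-ppoly 1) ∧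
          ‖Torus.partialDeriv i (Torus.partialDeriv j (u₁ t)) x‖ ≤ Cpoly 2 * (T₁ - t) ^ (-ppoly 2) ∧
          ‖Torus.partialDeriv i (Torus.partialDeriv j (Torus.partialDeriv k (u₁ t))) x‖ ≤
            Cpoly 3 * (T₁ - t) ^ (-ppoly 3) ∧
          ‖Torus.partialDeriv i (Torus.partialDeriv j (Torus.partialDeriv k (Torus.partialDeriv l (u₁ t)))) x‖ ≤
            Cpoly 4 * (T₁ - t) ^ (-ppoly 4)) ∧
        (|u₁ t x c| ≤ Cpoly 0 * (T₁ - t) ^ (-ppoly 0) ∧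
          |Torus.partialDeriv i (fun y => u₁ t y c) x| ≤ Cpoly 1 * (T₁ - t) ^ (-ppoly 1) ∧
          |Torus.partialDeriv i (Torus.partialDeriv j (fun y => u₁ t y c)) x| ≤ Cpoly 2 * (T₁ - t) ^ (-ppoly 2) ∧
          |Torus.partialDeriv i (Torus.partialDeriv j (Torus.partialDeriv k (fun y => u₁ t y c))) x| ≤
            Cpoly 3 * (T₁ - t) ^ (-ppoly 3) ∧
          |Torus.partialDeriv i (Torus.partialDeriv j (Torus.partialDeriv k
            (Torus.partialDeriv l (fun y => u₁ t y c)))) x| ≤ Cpoly 4 * (T₁ - t) ^ (-ppoly 4)) := by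
  intro σ₁ T T₁ Cpoly ppoly ρ₁ θ₁ u₁ hE hR t ht x i j k l c
  have hρ : Torus.IsSmooth (ρ₁ t) := hE.smooth_density.isSmooth_slice ht
  have hu : Torus.IsSmooth (u₁ t) := hE.smooth_velocity.isSmooth_slice ht
  have hMρ : ∀ n : ℕ, n ≤ 4 → ∀ y : EuclideanSpace ℝ (Fin 3),
      ‖iteratedFDeriv ℝ n (Torus.lift (ρ₁ t)) y‖ ≤ Cpoly n * (T₁ - t) ^ (-ppoly n) :=
    fun n hn y => (hR n (by omega) t ht y).1
  have hMu : ∀ n : ℕ, n ≤ 4 → ∀ y : EuclideanSpace ℝ (Fin 3),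
      ‖iteratedFDeriv ℝ n (Torus.lift (u₁ t)) y‖ ≤ Cpoly n * (T₁ - t) ^ (-ppoly n) :=
    fun n hn y => (hR n (by omega) t ht y).2
  have h0 : |ρ₁ t x| ≤ Cpoly 0 * (T₁ - t) ^ (-ppoly 0) := by
    simpa using torus_norm_iterPartialDeriv_le_of_lift_bound hρ (hMρ 0 (by norm_num)) [] rfl x
  exact ⟨⟨h0, torus_partialDeriv_iter_le_of_lift_bounds hρ hMρ x i j k l⟩,
    torus_partialDeriv_iter_le_of_lift_bounds_vec hu hMu x i j k l c⟩

/-- **The explicit reference envelope** (registered helper). From the reference clauses of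
`ShadowSetting` — classical solution, isentropic `θ₁ = K ρ₁^{2/3}` (`K ≥ 0`), Fréchet bounds (R) with
`n ≤ 6`, floor (F) with `cl > 0`, `T ≤ T₁` — at every `t ∈ [0, T)` and for every
`R ≥ Renv t := 576 (1 + K) (1 + Σ_{n<7} Cpoly n (T₁−t)^{−ppoly n})⁵ (1 + (cl (T₁−t)^{pl})⁻¹)⁵`:
the values and all nested partial derivatives of orders `1–4` of `ρ₁ t`, `θ₁ t`, `u₁ t` (in `V3`) and of
each component `u₁ t · c` are bounded by `R`. [folklore] -/
theorem shadow_reference_envelope :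
    ∀ {σ₁ K T T₁ cl pl : ℝ} {Cpoly ppoly : ℕ → ℝ} {ρ₁ θ₁ : ℝ → T3 → ℝ} {u₁ : ℝ → T3 → V3},
      IsHardSphereEulerSolution σ₁ T ρ₁ u₁ θ₁ → 0 ≤ K → 0 < cl → T ≤ T₁ →
      (∀ t ∈ Ico 0 T, ∀ x, θ₁ t x = K * ρ₁ t x ^ (2 / 3 : ℝ)) →
      (∀ n : ℕ, n ≤ 6 → ∀ t ∈ Ico 0 T, ∀ y : EuclideanSpace ℝ (Fin 3),
        ‖iteratedFDeriv ℝ n (Torus.lift (ρ₁ t)) y‖ ≤ Cpoly n * (T₁ - t) ^ (-ppoly n) ∧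
        ‖iteratedFDeriv ℝ n (Torus.lift (u₁ t)) y‖ ≤ Cpoly n * (T₁ - t) ^ (-ppoly n)) →
      (∀ t ∈ Ico 0 T, ∀ x, cl * (T₁ - t) ^ pl ≤ ρ₁ t x) →
      ∀ {t : ℝ}, t ∈ Ico 0 T → ∀ {R : ℝ},
        576 * (1 + K) * (1 + ∑ n ∈ Finset.range 7, Cpoly n * (T₁ - t) ^ (-ppoly n)) ^ 5 *
            (1 + (cl * (T₁ - t) ^ pl)⁻¹) ^ 5 ≤ R →
        ∀ (x : T3) (i j k l c : Fin 3),
          (|ρ₁ t x| ≤ R ∧ |Torus.partialDeriv i (ρ₁ t) x| ≤ R ∧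
            |Torus.partialDeriv i (Torus.partialDeriv j (ρ₁ t)) x| ≤ R ∧
            |Torus.partialDeriv i (Torus.partialDeriv j (Torus.partialDeriv k (ρ₁ t))) x| ≤ R ∧
            |Torus.partialDeriv i (Torus.partialDeriv j (Torus.partialDeriv k (Torus.partialDeriv l (ρ₁ t)))) x| ≤
              R) ∧
          (|θ₁ t x| ≤ R ∧ |Torus.partialDeriv i (θ₁ t) x| ≤ R ∧
            |Torus.partialDeriv i (Torus.partialDeriv j (θ₁ t)) x| ≤ R ∧
            |Torus.partialDeriv i (Torus.partialDeriv j (Torus.partialDeriv k (θ₁ t))) x| ≤ R ∧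
            |Torus.partialDeriv i (Torus.partialDeriv j (Torus.partialDeriv k (Torus.partialDeriv l (θ₁ t)))) x| ≤
              R) ∧
          (‖u₁ t x‖ ≤ R ∧ ‖Torus.partialDeriv i (u₁ t) x‖ ≤ R ∧
            ‖Torus.partialDeriv i (Torus.partialDeriv j (u₁ t)) x‖ ≤ R ∧
            ‖Torus.partialDeriv i (Torus.partialDeriv j (Torus.partialDeriv k (u₁ t))) x‖ ≤ R ∧
            ‖Torus.partialDeriv i (Torus.partialDeriv j (Torus.partialDeriv k (Torus.partialDeriv l (u₁ t)))) x‖ ≤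
              R) ∧
          (|u₁ t x c| ≤ R ∧ |Torus.partialDeriv i (fun y => u₁ t y c) x| ≤ R ∧
            |Torus.partialDeriv i (Torus.partialDeriv j (fun y => u₁ t y c)) x| ≤ R ∧
            |Torus.partialDeriv i (Torus.partialDeriv j (Torus.partialDeriv k (fun y => u₁ t y c))) x| ≤ R ∧
            |Torus.partialDeriv i (Torus.partialDeriv j (Torus.partialDeriv k
              (Torus.partialDeriv l (fun y => u₁ t y c)))) x| ≤ R) := by
  intro σ₁ K T T₁ cl pl Cpoly ppoly ρ₁ θ₁ u₁ hE hK hcl hT hisen hR hF t ht R hRle x i j k l c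
  set S : ℝ := ∑ n ∈ Finset.range 7, Cpoly n * (T₁ - t) ^ (-ppoly n) with hSdef
  set m : ℝ := cl * (T₁ - t) ^ pl with hmdef
  have hlam : 0 < T₁ - t := by linarith [ht.2]
  have hm : 0 < m := mul_pos hcl (Real.rpow_pos_of_pos hlam _)
  have hmi : (1 : ℝ) ≤ 1 + m⁻¹ := le_add_of_nonneg_right (inv_nonneg.2 hm.le)
  have hterm : ∀ n ∈ Finset.range 7, 0 ≤ Cpoly n * (T₁ - t) ^ (-ppoly n) := fun n hn =>
    (norm_nonneg _).trans (hR n (by have := Finset.mem_range.1 hn; omega) t ht 0).1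
  have hle : ∀ n : ℕ, n ≤ 4 → Cpoly n * (T₁ - t) ^ (-ppoly n) ≤ S := fun n hn =>
    Finset.single_le_sum hterm (Finset.mem_range.2 (by omega))
  have hρ : Torus.IsSmooth (ρ₁ t) := hE.smooth_density.isSmooth_slice ht
  have hu : Torus.IsSmooth (u₁ t) := hE.smooth_velocity.isSmooth_slice ht
  have hρS : ∀ n : ℕ, n ≤ 4 → ∀ y : EuclideanSpace ℝ (Fin 3), ‖iteratedFDeriv ℝ n (Torus.lift (ρ₁ t)) y‖ ≤ S :=
    fun n hn y => (hR n (by omega) t ht y).1.trans (hle n hn)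
  have huS : ∀ n : ℕ, n ≤ 4 → ∀ y : EuclideanSpace ℝ (Fin 3), ‖iteratedFDeriv ℝ n (Torus.lift (u₁ t)) y‖ ≤ S :=
    fun n hn y => (hR n (by omega) t ht y).2.trans (hle n hn)
  have hS0 : 0 ≤ S := (norm_nonneg _).trans (hρS 0 (by norm_num) 0)
  have hfl : ∀ x, m ≤ ρ₁ t x := hF t ht
  -- the envelope dominates `576 |a| (1+S)⁵ (1+m⁻¹)⁵` for `|a| ≤ 1 + K`, and `S`
  have hP0 : 0 ≤ (1 + S) ^ 5 * (1 + m⁻¹) ^ 5 := by positivity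
  have hP1 : 1 + S ≤ (1 + S) ^ 5 * (1 + m⁻¹) ^ 5 :=
    (le_self_pow₀ (by linarith) (by norm_num) : 1 + S ≤ (1 + S) ^ 5).trans
      (le_mul_of_one_le_right (pow_nonneg (by linarith) _) (one_le_pow₀ hmi))
  have hRenv : ∀ a : ℝ, |a| ≤ 1 + K → 576 * |a| * (1 + S) ^ 5 * (1 + m⁻¹) ^ 5 ≤ R := by
    intro a ha
    refine le_trans ?_ hRle
    calc 576 * |a| * (1 + S) ^ 5 * (1 + m⁻¹) ^ 5 = 576 * |a| * ((1 + S) ^ 5 * (1 + m⁻¹) ^ 5) := by ring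
      _ ≤ 576 * (1 + K) * ((1 + S) ^ 5 * (1 + m⁻¹) ^ 5) := by gcongr
      _ = _ := by ring
  have hSR : S ≤ R := by
    have h1 := hRenv 1 (by rw [abs_one]; linarith)
    rw [abs_one, mul_one] at h1
    calc S ≤ 1 + S := by linarith
      _ ≤ (1 + S) ^ 5 * (1 + m⁻¹) ^ 5 := hP1
      _ ≤ 576 * ((1 + S) ^ 5 * (1 + m⁻¹) ^ 5) := le_mul_of_one_le_left hP0 (by norm_num)
      _ = 576 * (1 + S) ^ 5 * (1 + m⁻¹) ^ 5 := by ring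
      _ ≤ R := h1
  have hKR := hRenv K (by rw [abs_of_nonneg hK]; linarith)
  -- `ρ₁`
  have hρ0 : |ρ₁ t x| ≤ S := by
    simpa using torus_norm_iterPartialDeriv_le_of_lift_bound hρ (hρS 0 (by norm_num)) [] rfl x
  obtain ⟨r1, r2, r3, r4⟩ := torus_partialDeriv_iter_le_of_lift_bounds hρ (M := fun _ => S) hρS x i j k l
  -- `θ₁ = K ρ₁^{2/3}`
  have hθfun : θ₁ t = fun y => K * ρ₁ t y ^ (2 / 3 : ℝ) := funext (hisen t ht)
  have hp : |(2 / 3 : ℝ)| ≤ 1 := by rw [abs_of_pos (by norm_num : (0 : ℝ) < 2 / 3)]; norm_num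
  obtain ⟨g0, g1, g2, g3, g4⟩ := torus_rpow_jet_le_of_lift_bounds hρ K (2 / 3 : ℝ) hm hfl hp hρS x i j k l
  -- `u₁`
  obtain ⟨⟨v0, v1, v2, v3, v4⟩, w0, w1, w2, w3, w4⟩ :=
    torus_partialDeriv_iter_le_of_lift_bounds_vec hu (M := fun _ => S) huS x i j k l c
  rw [hθfun]
  exact ⟨⟨hρ0.trans hSR, r1.trans hSR, r2.trans hSR, r3.trans hSR, r4.trans hSR⟩,
    ⟨g0.trans hKR, g1.trans hKR, g2.trans hKR, g3.trans hKR, g4.trans hKR⟩,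
    ⟨v0.trans hSR, v1.trans hSR, v2.trans hSR, v3.trans hSR, v4.trans hSR⟩,
    ⟨w0.trans hSR, w1.trans hSR, w2.trans hSR, w3.trans hSR, w4.trans hSR⟩⟩

/-- **Jet form of the reference envelope** (the hypothesis shape `|f x| ≤ F0`, `∀ i, |∂ᵢf x| ≤ F1`,
`∀ i j, |∂ᵢ∂ⱼf x| ≤ F2`, … of the pointwise `torusJet_*` product/chain bounds): under the clauses of
`shadow_reference_envelope`, at `t ∈ [0, T)`, `R ≥ Renv t` and any point `x`, the jets of orders `0–4` of
`ρ₁ t`, `θ₁ t` and of every component `u₁ t · c` are bounded by `R`. [folklore] -/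
theorem shadow_reference_jets :
    ∀ {σ₁ K T T₁ cl pl : ℝ} {Cpoly ppoly : ℕ → ℝ} {ρ₁ θ₁ : ℝ → T3 → ℝ} {u₁ : ℝ → T3 → V3},
      IsHardSphereEulerSolution σ₁ T ρ₁ u₁ θ₁ → 0 ≤ K → 0 < cl → T ≤ T₁ →
      (∀ t ∈ Ico 0 T, ∀ x, θ₁ t x = K * ρ₁ t x ^ (2 / 3 : ℝ)) →
      (∀ n : ℕ, n ≤ 6 → ∀ t ∈ Ico 0 T, ∀ y : EuclideanSpace ℝ (Fin 3),
        ‖iteratedFDeriv ℝ n (Torus.lift (ρ₁ t)) y‖ ≤ Cpoly n * (T₁ - t) ^ (-ppoly n) ∧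
        ‖iteratedFDeriv ℝ n (Torus.lift (u₁ t)) y‖ ≤ Cpoly n * (T₁ - t) ^ (-ppoly n)) →
      (∀ t ∈ Ico 0 T, ∀ x, cl * (T₁ - t) ^ pl ≤ ρ₁ t x) →
      ∀ {t : ℝ}, t ∈ Ico 0 T → ∀ {R : ℝ},
        576 * (1 + K) * (1 + ∑ n ∈ Finset.range 7, Cpoly n * (T₁ - t) ^ (-ppoly n)) ^ 5 *
            (1 + (cl * (T₁ - t) ^ pl)⁻¹) ^ 5 ≤ R →
        ∀ x : T3,
          (|ρ₁ t x| ≤ R ∧ (∀ i : Fin 3, |Torus.partialDeriv i (ρ₁ t) x| ≤ R) ∧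
            (∀ i j : Fin 3, |Torus.partialDeriv i (Torus.partialDeriv j (ρ₁ t)) x| ≤ R) ∧
            (∀ i j k : Fin 3, |Torus.partialDeriv i (Torus.partialDeriv j (Torus.partialDeriv k (ρ₁ t))) x| ≤ R) ∧
            (∀ i j k l : Fin 3, |Torus.partialDeriv i (Torus.partialDeriv j (Torus.partialDeriv k
              (Torus.partialDeriv l (ρ₁ t)))) x| ≤ R)) ∧
          (|θ₁ t x| ≤ R ∧ (∀ i : Fin 3, |Torus.partialDeriv i (θ₁ t) x| ≤ R) ∧
            (∀ i j : Fin 3, |Torus.partialDeriv i (Torus.partialDeriv j (θ₁ t)) x| ≤ R) ∧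
            (∀ i j k : Fin 3, |Torus.partialDeriv i (Torus.partialDeriv j (Torus.partialDeriv k (θ₁ t))) x| ≤ R) ∧
            (∀ i j k l : Fin 3, |Torus.partialDeriv i (Torus.partialDeriv j (Torus.partialDeriv k
              (Torus.partialDeriv l (θ₁ t)))) x| ≤ R)) ∧
          (∀ c : Fin 3, |u₁ t x c| ≤ R ∧ (∀ i : Fin 3, |Torus.partialDeriv i (fun y => u₁ t y c) x| ≤ R) ∧
            (∀ i j : Fin 3, |Torus.partialDeriv i (Torus.partialDeriv j (fun y => u₁ t y c)) x| ≤ R) ∧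
            (∀ i j k : Fin 3,
              |Torus.partialDeriv i (Torus.partialDeriv j (Torus.partialDeriv k (fun y => u₁ t y c))) x| ≤ R) ∧
            (∀ i j k l : Fin 3, |Torus.partialDeriv i (Torus.partialDeriv j (Torus.partialDeriv k
              (Torus.partialDeriv l (fun y => u₁ t y c)))) x| ≤ R)) := by
  intro σ₁ K T T₁ cl pl Cpoly ppoly ρ₁ θ₁ u₁ hE hK hcl hT hisen hR hF t ht R hRle x
  have h := fun i j k l c => shadow_reference_envelope hE hK hcl hT hisen hR hF ht hRle x i j k l c
  refine ⟨⟨(h 0 0 0 0 0).1.1, fun i => (h i 0 0 0 0).1.2.1, fun i j => (h i j 0 0 0).1.2.2.1,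
      fun i j k => (h i j k 0 0).1.2.2.2.1, fun i j k l => (h i j k l 0).1.2.2.2.2⟩,
    ⟨(h 0 0 0 0 0).2.1.1, fun i => (h i 0 0 0 0).2.1.2.1, fun i j => (h i j 0 0 0).2.1.2.2.1,
      fun i j k => (h i j k 0 0).2.1.2.2.2.1, fun i j k l => (h i j k l 0).2.1.2.2.2.2⟩,
    fun c => ⟨(h 0 0 0 0 c).2.2.2.1, fun i => (h i 0 0 0 c).2.2.2.2.1, fun i j => (h i j 0 0 c).2.2.2.2.2.1,
      fun i j k => (h i j k 0 c).2.2.2.2.2.2.1, fun i j k l => (h i j k l c).2.2.2.2.2.2.2⟩⟩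

/-- **The reference envelope, weights part**: under the same clauses, at `t ∈ [0, T)` with
`m_t := cl (T₁−t)^{pl}` and `R ≥ Renv t`: `0 < m_t ≤ ρ₁`, `m_t^{1/3} ≤ c₁ := ρ₁^{1/3} ≤ R`,
`ρ₁⁻¹ ≤ m_t⁻¹ ≤ R`, `c₁⁻¹ ≤ m_t^{−1/3} ≤ R`, `1 ≤ R`, and the nested partial derivatives of orders `1–4`
of `c₁`, `ρ₁⁻¹`, `c₁⁻¹` are `≤ R`. [folklore] -/
theorem shadow_reference_envelope_weights :
    ∀ {σ₁ K T T₁ cl pl : ℝ} {Cpoly ppoly : ℕ → ℝ} {ρ₁ θ₁ : ℝ → T3 → ℝ} {u₁ : ℝ → T3 → V3},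
      IsHardSphereEulerSolution σ₁ T ρ₁ u₁ θ₁ → 0 ≤ K → 0 < cl → T ≤ T₁ →
      (∀ n : ℕ, n ≤ 6 → ∀ t ∈ Ico 0 T, ∀ y : EuclideanSpace ℝ (Fin 3),
        ‖iteratedFDeriv ℝ n (Torus.lift (ρ₁ t)) y‖ ≤ Cpoly n * (T₁ - t) ^ (-ppoly n) ∧
        ‖iteratedFDeriv ℝ n (Torus.lift (u₁ t)) y‖ ≤ Cpoly n * (T₁ - t) ^ (-ppoly n)) →
      (∀ t ∈ Ico 0 T, ∀ x, cl * (T₁ - t) ^ pl ≤ ρ₁ t x) →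
      ∀ {t : ℝ}, t ∈ Ico 0 T → ∀ {R : ℝ},
        576 * (1 + K) * (1 + ∑ n ∈ Finset.range 7, Cpoly n * (T₁ - t) ^ (-ppoly n)) ^ 5 *
            (1 + (cl * (T₁ - t) ^ pl)⁻¹) ^ 5 ≤ R →
        ∀ (x : T3) (i j k l : Fin 3),
          (1 ≤ R ∧ 0 < cl * (T₁ - t) ^ pl ∧ 0 < ρ₁ t x ∧ cl * (T₁ - t) ^ pl ≤ ρ₁ t x ∧
            (cl * (T₁ - t) ^ pl) ^ (1 / 3 : ℝ) ≤ ρ₁ t x ^ (1 / 3 : ℝ) ∧ ρ₁ t x ^ (1 / 3 : ℝ) ≤ R ∧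
            (ρ₁ t x)⁻¹ ≤ (cl * (T₁ - t) ^ pl)⁻¹ ∧ (cl * (T₁ - t) ^ pl)⁻¹ ≤ R ∧
            (ρ₁ t x ^ (1 / 3 : ℝ))⁻¹ ≤ (cl * (T₁ - t) ^ pl) ^ (-(1 / 3) : ℝ) ∧
            (cl * (T₁ - t) ^ pl) ^ (-(1 / 3) : ℝ) ≤ R) ∧
          (|Torus.partialDeriv i (fun y => ρ₁ t y ^ (1 / 3 : ℝ)) x| ≤ R ∧
            |Torus.partialDeriv i (Torus.partialDeriv j (fun y => ρ₁ t y ^ (1 / 3 : ℝ))) x| ≤ R ∧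
            |Torus.partialDeriv i (Torus.partialDeriv j (Torus.partialDeriv k (fun y => ρ₁ t y ^ (1 / 3 : ℝ)))) x| ≤
              R ∧
            |Torus.partialDeriv i (Torus.partialDeriv j (Torus.partialDeriv k
              (Torus.partialDeriv l (fun y => ρ₁ t y ^ (1 / 3 : ℝ))))) x| ≤ R) ∧
          (|Torus.partialDeriv i (fun y => (ρ₁ t y)⁻¹) x| ≤ R ∧
            |Torus.partialDeriv i (Torus.partialDeriv j (fun y => (ρ₁ t y)⁻¹)) x| ≤ R ∧
            |Torus.partialDeriv i (Torus.partialDeriv j (Torus.partialDeriv k (fun y => (ρ₁ t y)⁻¹))) x| ≤ R ∧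
            |Torus.partialDeriv i (Torus.partialDeriv j (Torus.partialDeriv k
              (Torus.partialDeriv l (fun y => (ρ₁ t y)⁻¹)))) x| ≤ R) ∧
          (|Torus.partialDeriv i (fun y => (ρ₁ t y ^ (1 / 3 : ℝ))⁻¹) x| ≤ R ∧
            |Torus.partialDeriv i (Torus.partialDeriv j (fun y => (ρ₁ t y ^ (1 / 3 : ℝ))⁻¹)) x| ≤ R ∧
            |Torus.partialDeriv i (Torus.partialDeriv j (Torus.partialDeriv k
              (fun y => (ρ₁ t y ^ (1 / 3 : ℝ))⁻¹))) x| ≤ R ∧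
            |Torus.partialDeriv i (Torus.partialDeriv j (Torus.partialDeriv k
              (Torus.partialDeriv l (fun y => (ρ₁ t y ^ (1 / 3 : ℝ))⁻¹)))) x| ≤ R) := by
  intro σ₁ K T T₁ cl pl Cpoly ppoly ρ₁ θ₁ u₁ hE hK hcl hT hR hF t ht R hRle x i j k l
  set S : ℝ := ∑ n ∈ Finset.range 7, Cpoly n * (T₁ - t) ^ (-ppoly n) with hSdef
  set m : ℝ := cl * (T₁ - t) ^ pl with hmdef
  have hlam : 0 < T₁ - t := by linarith [ht.2]
  have hm : 0 < m := mul_pos hcl (Real.rpow_pos_of_pos hlam _)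
  have hmi : (1 : ℝ) ≤ 1 + m⁻¹ := le_add_of_nonneg_right (inv_nonneg.2 hm.le)
  have hterm : ∀ n ∈ Finset.range 7, 0 ≤ Cpoly n * (T₁ - t) ^ (-ppoly n) := fun n hn =>
    (norm_nonneg _).trans (hR n (by have := Finset.mem_range.1 hn; omega) t ht 0).1
  have hle : ∀ n : ℕ, n ≤ 4 → Cpoly n * (T₁ - t) ^ (-ppoly n) ≤ S := fun n hn =>
    Finset.single_le_sum hterm (Finset.mem_range.2 (by omega))
  have hρ : Torus.IsSmooth (ρ₁ t) := hE.smooth_density.isSmooth_slice ht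
  have hρS : ∀ n : ℕ, n ≤ 4 → ∀ y : EuclideanSpace ℝ (Fin 3), ‖iteratedFDeriv ℝ n (Torus.lift (ρ₁ t)) y‖ ≤ S :=
    fun n hn y => (hR n (by omega) t ht y).1.trans (hle n hn)
  have hS0 : 0 ≤ S := (norm_nonneg _).trans (hρS 0 (by norm_num) 0)
  have hfl : ∀ x, m ≤ ρ₁ t x := hF t ht
  have hpos : ∀ x, 0 < ρ₁ t x := fun x => hE.density_pos t ht x
  have hρ0 : |ρ₁ t x| ≤ S := by
    simpa using torus_norm_iterPartialDeriv_le_of_lift_bound hρ (hρS 0 (by norm_num)) [] rfl x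
  have hmS : m ≤ S := ((hfl x).trans (le_abs_self _)).trans hρ0
  -- the envelope dominates `576 (1+S)⁵ (1+m⁻¹)⁵ ≥ (1+S)(1+m⁻¹) ≥ 1 + m⁻¹`
  have hP0 : 0 ≤ (1 + S) ^ 5 * (1 + m⁻¹) ^ 5 := by positivity
  have h1R : 576 * (1 + S) ^ 5 * (1 + m⁻¹) ^ 5 ≤ R := by
    refine le_trans ?_ hRle
    calc 576 * (1 + S) ^ 5 * (1 + m⁻¹) ^ 5 = 576 * 1 * ((1 + S) ^ 5 * (1 + m⁻¹) ^ 5) := by ring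
      _ ≤ 576 * (1 + K) * ((1 + S) ^ 5 * (1 + m⁻¹) ^ 5) := by gcongr; linarith
      _ = _ := by ring
  have hQR : (1 + S) * (1 + m⁻¹) ≤ R := by
    refine le_trans ?_ h1R
    calc (1 + S) * (1 + m⁻¹) = (1 + S) ^ 1 * (1 + m⁻¹) ^ 1 := by ring
      _ ≤ (1 + S) ^ 5 * (1 + m⁻¹) ^ 5 :=
          mul_le_mul (pow_le_pow_right₀ (by linarith) (by norm_num)) (pow_le_pow_right₀ hmi (by norm_num))
            (by positivity) (by positivity)
      _ ≤ 576 * ((1 + S) ^ 5 * (1 + m⁻¹) ^ 5) := le_mul_of_one_le_left hP0 (by norm_num)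
      _ = _ := by ring
  have hmiR : m⁻¹ ≤ R := by
    refine le_trans ?_ hQR
    calc m⁻¹ ≤ 1 + m⁻¹ := by linarith
      _ ≤ (1 + S) * (1 + m⁻¹) := le_mul_of_one_le_left (by positivity) (by linarith)
  have hm3R : m ^ (-(1 / 3) : ℝ) ≤ R := by
    have h := rpow_sub_nat_le_of_floor (p := -(1 / 3)) 0 hm le_rfl hmS
      (by rw [abs_neg, abs_of_pos (by norm_num : (0 : ℝ) < 1 / 3)]; norm_num)
    rw [Nat.cast_zero, sub_zero, zero_add, pow_one] at h
    exact h.trans hQR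
  -- jets of `ρ₁^{1/3}`, `ρ₁^{-1}`, `ρ₁^{-1/3}`
  have hp3 : |(1 / 3 : ℝ)| ≤ 1 := by rw [abs_of_pos (by norm_num : (0 : ℝ) < 1 / 3)]; norm_num
  have hpm3 : |(-(1 / 3) : ℝ)| ≤ 1 := by rw [abs_neg]; exact hp3
  have hpm1 : |(-1 : ℝ)| ≤ 1 := by rw [abs_neg, abs_one]
  obtain ⟨c0, c1, c2, c3, c4⟩ := torus_rpow_jet_le_of_lift_bounds' hρ (1 / 3 : ℝ) hm hfl hp3 hρS x i j k l
  obtain ⟨-, a1, a2, a3, a4⟩ := torus_rpow_jet_le_of_lift_bounds' hρ (-1 : ℝ) hm hfl hpm1 hρS x i j k l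
  obtain ⟨-, b1, b2, b3, b4⟩ := torus_rpow_jet_le_of_lift_bounds' hρ (-(1 / 3) : ℝ) hm hfl hpm3 hρS x i j k l
  have hinvfun : (fun y => (ρ₁ t y)⁻¹) = fun y => ρ₁ t y ^ (-1 : ℝ) :=
    funext fun y => (Real.rpow_neg_one _).symm
  have hcinvfun : (fun y => (ρ₁ t y ^ (1 / 3 : ℝ))⁻¹) = fun y => ρ₁ t y ^ (-(1 / 3) : ℝ) :=
    funext fun y => (Real.rpow_neg (hpos y).le _).symm
  have hc0 : ρ₁ t x ^ (1 / 3 : ℝ) ≤ R := ((le_abs_self _).trans c0).trans h1R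
  have h1le : 1 ≤ R := by
    refine le_trans ?_ hQR
    calc (1 : ℝ) = 1 * 1 := (one_mul _).symm
      _ ≤ (1 + S) * (1 + m⁻¹) := mul_le_mul (by linarith) hmi zero_le_one (by linarith)
  refine ⟨⟨h1le, hm, hpos x, hfl x, Real.rpow_le_rpow hm.le (hfl x) (by norm_num), hc0,
      inv_anti₀ hm (hfl x), hmiR, ?_, hm3R⟩,
    ⟨c1.trans h1R, c2.trans h1R, c3.trans h1R, c4.trans h1R⟩, ?_, ?_⟩
  · rw [← Real.rpow_neg (hpos x).le]
    exact Real.rpow_le_rpow_of_nonpos hm (hfl x) (by norm_num)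
  · rw [hinvfun]
    exact ⟨a1.trans h1R, a2.trans h1R, a3.trans h1R, a4.trans h1R⟩
  · rw [hcinvfun]
    exact ⟨b1.trans h1R, b2.trans h1R, b3.trans h1R, b4.trans h1R⟩

/-- **Continuity of the reference envelope** on `(-∞, T₁)` (`cl > 0`). [folklore] -/
theorem shadow_reference_envelope_continuousOn :
    ∀ (K T₁ cl pl : ℝ) (Cpoly ppoly : ℕ → ℝ), 0 < cl →
      ContinuousOn (fun t : ℝ => 576 * (1 + K) * (1 + ∑ n ∈ Finset.range 7, Cpoly n * (T₁ - t) ^ (-ppoly n)) ^ 5 *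
        (1 + (cl * (T₁ - t) ^ pl)⁻¹) ^ 5) (Iio T₁) := by
  intro K T₁ cl pl Cpoly ppoly hcl
  have hb : ∀ t ∈ Iio T₁, T₁ - t ≠ 0 := fun t ht => (sub_pos.2 (mem_Iio.1 ht)).ne'
  have hbase : ContinuousOn (fun t : ℝ => T₁ - t) (Iio T₁) := continuousOn_const.sub continuousOn_id
  have hS : ContinuousOn (fun t : ℝ => ∑ n ∈ Finset.range 7, Cpoly n * (T₁ - t) ^ (-ppoly n)) (Iio T₁) :=
    continuousOn_finsetSum _ fun n _ => continuousOn_const.mul (hbase.rpow_const fun t ht => Or.inl (hb t ht))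
  have hm : ContinuousOn (fun t : ℝ => (cl * (T₁ - t) ^ pl)⁻¹) (Iio T₁) :=
    (continuousOn_const.mul (hbase.rpow_const fun t ht => Or.inl (hb t ht))).inv₀ fun t ht =>
      (mul_pos hcl (Real.rpow_pos_of_pos (sub_pos.2 (mem_Iio.1 ht)) _)).ne'
  exact (continuousOn_const.mul ((continuousOn_const.add hS).pow 5)).mul ((continuousOn_const.add hm).pow 5)

/-- **Continuity of the reference envelope on `[0, T)`** for `T ≤ T₁` (the shape consumed by the energy
shell `torus_energy_le_of_balance`). [folklore] -/
theorem shadow_reference_envelope_continuousOn_Ico :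
    ∀ (K T T₁ cl pl : ℝ) (Cpoly ppoly : ℕ → ℝ), 0 < cl → T ≤ T₁ →
      ContinuousOn (fun t : ℝ => 576 * (1 + K) * (1 + ∑ n ∈ Finset.range 7, Cpoly n * (T₁ - t) ^ (-ppoly n)) ^ 5 *
        (1 + (cl * (T₁ - t) ^ pl)⁻¹) ^ 5) (Ico 0 T) := by
  intro K T T₁ cl pl Cpoly ppoly hcl hT
  exact (shadow_reference_envelope_continuousOn K T₁ cl pl Cpoly ppoly hcl).mono fun t ht =>
    mem_Iio.2 (lt_of_lt_of_le ht.2 hT)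

end Summit.AtomisticToContinuum.HydrodynamicLimit.Theorems

end
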